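import Mathlib
import Literature.Analysis.ODE.InverseSquareSqrtTails

/-!
# The Volterra tail operator for `u'' = (ℓ(ℓ+1)/x² + W) u` at `+∞`, `W = O(1/(x²√x))`

Analysis/ODE support file (everything proved, no definitions). Writing `u = x^{-ℓ} v`, the equation
`u'' = (ℓ(ℓ+1)/x² + W)u` on a half-line `[X, ∞)` (`X ≥ 1`, `W` continuous with `|W| ≤ A/(x²√x)`)
becomes `(x^{-2ℓ} v')' = x^{-2ℓ} W v`, whose solution recessive at `+∞` solves the Volterra equation
`v = 1 + (2ℓ+1)⁻¹ [∫_x^∞ y F − x^{2ℓ+1} ∫_x^∞ F/y^{2ℓ}]` with `F = W v`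
(`InverseSquareTailRecessive.lean`). This file provides the calculus of the TAIL OPERATOR
`F ↦ ∫_x^∞ y F − x^{2ℓ+1} ∫_x^∞ F/y^{2ℓ}` for `F` continuous on `[X, ∞)` with `|F| ≤ B/(y²√y)`:
* tails `x ↦ ∫_x^∞ f` of a function continuous on `[X, ∞)` and integrable: splitting at `x ≥ X`,
  continuity of the clamped tail `x ↦ ∫_{max x X}^∞ f`, and `d/dx ∫_x^∞ f = −f(x)` on `(X, ∞)`;
* the size `|∫_x^∞ yF − x^{2ℓ+1}∫_x^∞ F/y^{2ℓ}| ≤ (8/3)B/√x`, continuity of the clamped operator,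
  its derivative `−(2ℓ+1)x^{2ℓ}∫_x^∞ F/y^{2ℓ}`, the derivative of `x^{2ℓ}∫_x^∞ F/y^{2ℓ}`, and
  linearity in `F`.
(Hartman, *Ordinary Differential Equations*, Ch. X §1, Ch. XI §9 — asymptotic integration; folklore.
Use: far-side kernel of the Regge–Wheeler channel estimate, route PhotonSphereChannels,
`FixedModeChannels`, stmt-FinalStateConjecture-10048.)
-/

noncomputable section

namespace Literature.Analysis.ODE

open MeasureTheory Set Filter Topology BoundedContinuousFunction

/-! ### Tails `x ↦ ∫_x^∞ f` of a function continuous on `[X, ∞)`: splitting, continuity, derivative -/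

section Tails

variable {f : ℝ → ℝ} {X : ℝ}

/-- The clamped function `y ↦ f (max y X)` is continuous on `ℝ` when `f` is continuous on `[X, ∞)`. [folklore] -/
theorem continuous_comp_max_of_continuousOn (hf : ContinuousOn f (Ici X)) :
    Continuous fun y => f (max y X) :=
  hf.comp_continuous (continuous_id.max continuous_const) fun y => (le_max_right y X : X ≤ max y X)

/-- Splitting a tail at `x ≥ X`: `∫_{(x,∞)} f = ∫_{(X,∞)} f − ∫_X^x f(max · X)`. [folklore] -/
theorem integral_Ioi_eq_sub_primitive (hfi : IntegrableOn f (Ioi X)) {x : ℝ} (hx : X ≤ x) :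
    ∫ y in Ioi x, f y = (∫ y in Ioi X, f y) - ∫ y in X..x, f (max y X) := by
  have heq : ∀ {z : ℝ}, X ≤ z → ∫ y in Ioi z, f y = ∫ y in Ioi z, f (max y X) := fun {z} hz =>
    setIntegral_congr_fun measurableSet_Ioi fun y hy => by
      rw [max_eq_left (hz.trans (le_of_lt hy))]
  have hfi' : IntegrableOn (fun y => f (max y X)) (Ioi X) :=
    hfi.congr_fun (fun y hy => by rw [max_eq_left (le_of_lt hy)]) measurableSet_Ioi
  rw [heq hx, heq le_rfl, ← intervalIntegral.integral_Ioi_sub_Ioi hfi' hx]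
  ring

/-- Continuity of the clamped tail `x ↦ ∫_{(max x X, ∞)} f`. [folklore] -/
theorem continuous_integral_Ioi_max (hf : ContinuousOn f (Ici X)) (hfi : IntegrableOn f (Ioi X)) :
    Continuous fun x => ∫ y in Ioi (max x X), f y := by
  have hc := continuous_comp_max_of_continuousOn hf
  have hprim : Continuous fun b => ∫ y in X..b, f (max y X) :=
    intervalIntegral.continuous_primitive (fun a b => hc.intervalIntegrable a b) X
  have : (fun x => ∫ y in Ioi (max x X), f y)
      = fun x => (∫ y in Ioi X, f y) - ∫ y in X..(max x X), f (max y X) :=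
    funext fun x => integral_Ioi_eq_sub_primitive hfi (le_max_right _ _)
  rw [this]
  exact continuous_const.sub (hprim.comp (continuous_id.max continuous_const))

/-- Continuity of the tail on `[X, ∞)`. [folklore] -/
theorem continuousOn_integral_Ioi (hf : ContinuousOn f (Ici X)) (hfi : IntegrableOn f (Ioi X)) :
    ContinuousOn (fun x => ∫ y in Ioi x, f y) (Ici X) := by
  have h := (continuous_integral_Ioi_max hf hfi).continuousOn (s := Ici X)
  refine h.congr fun x hx => ?_
  simp only [max_eq_left (show X ≤ x from hx)]

/-- **Derivative of the tail**: `d/dx ∫_{(x,∞)} f = −f(x)` at every `x > X`. [folklore] -/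
theorem hasDerivAt_integral_Ioi (hf : ContinuousOn f (Ici X)) (hfi : IntegrableOn f (Ioi X))
    {x : ℝ} (hx : X < x) :
    HasDerivAt (fun x => ∫ y in Ioi x, f y) (-f x) x := by
  have hc := continuous_comp_max_of_continuousOn hf
  have hprim : HasDerivAt (fun b => ∫ y in X..b, f (max y X)) (f (max x X)) x :=
    intervalIntegral.integral_hasDerivAt_right (hc.intervalIntegrable _ _)
      (hc.stronglyMeasurableAtFilter _ _) hc.continuousAt
  rw [max_eq_left hx.le] at hprim
  have h2 : HasDerivAt (fun b => (∫ y in Ioi X, f y) - ∫ y in X..b, f (max y X)) (-f x) x := by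
    simpa using hprim.const_sub (∫ y in Ioi X, f y)
  refine h2.congr_of_eventuallyEq ?_
  filter_upwards [Ioi_mem_nhds hx] with z hz
  exact integral_Ioi_eq_sub_primitive hfi (le_of_lt hz)

end Tails

/-! ### The Volterra tail operator `F ↦ ∫_x^∞ y F − x^{2ℓ+1} ∫_x^∞ y^{-2ℓ} F` -/

section TailOp

variable {F : ℝ → ℝ} {X B : ℝ} (ℓ : ℕ)

/-- **Size of the tail operator**: for `F` continuous on `[X, ∞)` (`X ≥ 1`) with `|F(y)| ≤ B/(y²√y)`,
`|∫_x^∞ y F − x^{2ℓ+1} ∫_x^∞ F/y^{2ℓ}| ≤ (8/3) B/√x` for `x ≥ X`. [folklore] -/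
theorem abs_tailOp_le (hX : 1 ≤ X) (hF : ContinuousOn F (Ici X))
    (hFB : ∀ y, X ≤ y → |F y| ≤ B / (y ^ 2 * Real.sqrt y)) {x : ℝ} (hx : X ≤ x) :
    |(∫ y in Ioi x, y * F y) - x ^ (2 * ℓ + 1) * ∫ y in Ioi x, F y / y ^ (2 * ℓ)|
      ≤ 8 / 3 * B / Real.sqrt x := by
  have hx0 : 0 < x := lt_of_lt_of_le one_pos (hX.trans hx)
  have hs : 0 < Real.sqrt x := Real.sqrt_pos.2 hx0
  have hB : 0 ≤ B := nonneg_of_abs_le_div_sqrt (lt_of_lt_of_le one_pos hX) (hFB X le_rfl)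
  have h1 := abs_integral_mul_of_sqrtTail_le hX hF hFB hx
  have h2 := abs_integral_div_pow_of_sqrtTail_le hX hF hFB ℓ hx
  have h3 : |x ^ (2 * ℓ + 1) * ∫ y in Ioi x, F y / y ^ (2 * ℓ)| ≤ 2 * B / (3 * Real.sqrt x) := by
    rw [abs_mul, abs_of_pos (pow_pos hx0 _)]
    calc x ^ (2 * ℓ + 1) * |∫ y in Ioi x, F y / y ^ (2 * ℓ)|
        ≤ x ^ (2 * ℓ + 1) * (2 * B / ((4 * ℓ + 3) * (x ^ (2 * ℓ + 1) * Real.sqrt x))) :=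
          mul_le_mul_of_nonneg_left h2 (pow_pos hx0 _).le
      _ = 2 * B / ((4 * ℓ + 3) * Real.sqrt x) := by field_simp
      _ ≤ 2 * B / (3 * Real.sqrt x) := by
          apply div_le_div_of_nonneg_left (by positivity) (by positivity)
          have : (0 : ℝ) ≤ 4 * ℓ * Real.sqrt x := by positivity
          nlinarith
  calc |(∫ y in Ioi x, y * F y) - x ^ (2 * ℓ + 1) * ∫ y in Ioi x, F y / y ^ (2 * ℓ)|
      ≤ |∫ y in Ioi x, y * F y| + |x ^ (2 * ℓ + 1) * ∫ y in Ioi x, F y / y ^ (2 * ℓ)| := abs_sub _ _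
    _ ≤ 2 * B / Real.sqrt x + 2 * B / (3 * Real.sqrt x) := add_le_add h1 h3
    _ = 8 / 3 * B / Real.sqrt x := by field_simp; ring

/-- **Continuity of the clamped tail operator** `x ↦ ∫_{x̂}^∞ y F − x̂^{2ℓ+1} ∫_{x̂}^∞ F/y^{2ℓ}`,
`x̂ = max x X`. [folklore] -/
theorem continuous_tailOp_max (hX : 1 ≤ X) (hF : ContinuousOn F (Ici X))
    (hFB : ∀ y, X ≤ y → |F y| ≤ B / (y ^ 2 * Real.sqrt y)) :
    Continuous fun x => (∫ y in Ioi (max x X), y * F y)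
      - (max x X) ^ (2 * ℓ + 1) * ∫ y in Ioi (max x X), F y / y ^ (2 * ℓ) := by
  have hX0 : 0 < X := lt_of_lt_of_le one_pos hX
  have hc1 : ContinuousOn (fun y => y * F y) (Ici X) := continuousOn_id.mul hF
  have hc2 : ContinuousOn (fun y => F y / y ^ (2 * ℓ)) (Ici X) :=
    hF.div (continuousOn_id.pow _) fun y hy => pow_ne_zero _ (hX0.trans_le hy).ne'
  have hi1 := integrableOn_mul_of_sqrtTail hX hF hFB le_rfl
  have hi2 := integrableOn_div_pow_of_sqrtTail hX hF hFB ℓ le_rfl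
  exact (continuous_integral_Ioi_max hc1 hi1).sub
    (((continuous_id.max continuous_const).pow _).mul (continuous_integral_Ioi_max hc2 hi2))

/-- **Derivative of the tail operator** at `x > X`:
`d/dx [∫_x^∞ y F − x^{2ℓ+1} ∫_x^∞ F/y^{2ℓ}] = −(2ℓ+1) x^{2ℓ} ∫_x^∞ F/y^{2ℓ}`. [folklore] -/
theorem hasDerivAt_tailOp (hX : 1 ≤ X) (hF : ContinuousOn F (Ici X))
    (hFB : ∀ y, X ≤ y → |F y| ≤ B / (y ^ 2 * Real.sqrt y)) {x : ℝ} (hx : X < x) :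
    HasDerivAt (fun x => (∫ y in Ioi x, y * F y) - x ^ (2 * ℓ + 1) * ∫ y in Ioi x, F y / y ^ (2 * ℓ))
      (-((2 * ℓ + 1) * x ^ (2 * ℓ) * ∫ y in Ioi x, F y / y ^ (2 * ℓ))) x := by
  have hX0 : 0 < X := lt_of_lt_of_le one_pos hX
  have hx0 : 0 < x := hX0.trans hx
  have hc1 : ContinuousOn (fun y => y * F y) (Ici X) := continuousOn_id.mul hF
  have hc2 : ContinuousOn (fun y => F y / y ^ (2 * ℓ)) (Ici X) :=
    hF.div (continuousOn_id.pow _) fun y hy => pow_ne_zero _ (hX0.trans_le hy).ne'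
  have hi1 := integrableOn_mul_of_sqrtTail hX hF hFB le_rfl
  have hi2 := integrableOn_div_pow_of_sqrtTail hX hF hFB ℓ le_rfl
  have hd1 := hasDerivAt_integral_Ioi hc1 hi1 hx
  have hd2 := hasDerivAt_integral_Ioi hc2 hi2 hx
  have hd3 : HasDerivAt (fun x : ℝ => x ^ (2 * ℓ + 1)) (((2 * ℓ + 1 : ℕ) : ℝ) * x ^ (2 * ℓ)) x := by
    simpa using hasDerivAt_pow (2 * ℓ + 1) x
  have h := hd1.sub (hd3.mul hd2)
  refine h.congr_deriv ?_
  have hxp : x ^ (2 * ℓ + 1) * (F x / x ^ (2 * ℓ)) = x * F x := by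
    rw [pow_succ]; field_simp
  push_cast
  rw [show x ^ (2 * ℓ + 1) * -(F x / x ^ (2 * ℓ)) = -(x * F x) by rw [mul_neg, hxp]]
  ring

/-- **Derivative of `x^{2ℓ} ∫_x^∞ F/y^{2ℓ}`** at `x > X`:
`d/dx = (2ℓ/x)·(x^{2ℓ} ∫_x^∞ F/y^{2ℓ}) − F(x)`. [folklore] -/
theorem hasDerivAt_pow_mul_tail (hX : 1 ≤ X) (hF : ContinuousOn F (Ici X))
    (hFB : ∀ y, X ≤ y → |F y| ≤ B / (y ^ 2 * Real.sqrt y)) {x : ℝ} (hx : X < x) :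
    HasDerivAt (fun x => x ^ (2 * ℓ) * ∫ y in Ioi x, F y / y ^ (2 * ℓ))
      (2 * ℓ / x * (x ^ (2 * ℓ) * ∫ y in Ioi x, F y / y ^ (2 * ℓ)) - F x) x := by
  have hX0 : 0 < X := lt_of_lt_of_le one_pos hX
  have hx0 : 0 < x := hX0.trans hx
  have hc2 : ContinuousOn (fun y => F y / y ^ (2 * ℓ)) (Ici X) :=
    hF.div (continuousOn_id.pow _) fun y hy => pow_ne_zero _ (hX0.trans_le hy).ne'
  have hi2 := integrableOn_div_pow_of_sqrtTail hX hF hFB ℓ le_rfl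
  have hd2 := hasDerivAt_integral_Ioi hc2 hi2 hx
  have hd3 : HasDerivAt (fun x : ℝ => x ^ (2 * ℓ)) (((2 * ℓ : ℕ) : ℝ) * x ^ (2 * ℓ - 1)) x := by
    simpa using hasDerivAt_pow (2 * ℓ) x
  have h := hd3.mul hd2
  refine h.congr_deriv ?_
  have hpow : ((2 * ℓ : ℕ) : ℝ) * x ^ (2 * ℓ - 1) = 2 * ℓ / x * x ^ (2 * ℓ) := by
    rcases Nat.eq_zero_or_pos ℓ with hl | hl
    · subst hl; simp
    · have : x ^ (2 * ℓ) = x ^ (2 * ℓ - 1) * x := by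
        rw [← pow_succ, Nat.sub_add_cancel (by omega)]
      rw [this]; push_cast; field_simp
  have hxp : x ^ (2 * ℓ) * (F x / x ^ (2 * ℓ)) = F x := by field_simp
  rw [hpow, show x ^ (2 * ℓ) * -(F x / x ^ (2 * ℓ)) = -F x by rw [mul_neg, hxp]]
  ring

/-- **Linearity of the tail operator in `F`** (for two functions both `O(1/(y²√y))`, `x ≥ X`). [folklore] -/
theorem tailOp_sub (hX : 1 ≤ X) (hF : ContinuousOn F (Ici X))
    (hFB : ∀ y, X ≤ y → |F y| ≤ B / (y ^ 2 * Real.sqrt y)) {G : ℝ → ℝ} {B' : ℝ}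
    (hG : ContinuousOn G (Ici X)) (hGB : ∀ y, X ≤ y → |G y| ≤ B' / (y ^ 2 * Real.sqrt y))
    {x : ℝ} (hx : X ≤ x) :
    ((∫ y in Ioi x, y * F y) - x ^ (2 * ℓ + 1) * ∫ y in Ioi x, F y / y ^ (2 * ℓ))
      - ((∫ y in Ioi x, y * G y) - x ^ (2 * ℓ + 1) * ∫ y in Ioi x, G y / y ^ (2 * ℓ))
      = (∫ y in Ioi x, y * (F y - G y)) - x ^ (2 * ℓ + 1) * ∫ y in Ioi x, (F y - G y) / y ^ (2 * ℓ) := by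
  have hi1 := integrableOn_mul_of_sqrtTail hX hF hFB hx
  have hi2 := integrableOn_div_pow_of_sqrtTail hX hF hFB ℓ hx
  have hj1 := integrableOn_mul_of_sqrtTail hX hG hGB hx
  have hj2 := integrableOn_div_pow_of_sqrtTail hX hG hGB ℓ hx
  have e1 : (∫ y in Ioi x, y * (F y - G y)) = (∫ y in Ioi x, y * F y) - ∫ y in Ioi x, y * G y := by
    rw [← integral_sub hi1 hj1]
    exact integral_congr_ae (Eventually.of_forall fun y => by ring)
  have e2 : (∫ y in Ioi x, (F y - G y) / y ^ (2 * ℓ))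
      = (∫ y in Ioi x, F y / y ^ (2 * ℓ)) - ∫ y in Ioi x, G y / y ^ (2 * ℓ) := by
    rw [← integral_sub hi2 hj2]
    exact integral_congr_ae (Eventually.of_forall fun y => by ring)
  rw [e1, e2]
  ring

end TailOp

end Literature.Analysis.ODE
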